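import Summits.QuantumFields.YangMills.Theorems.BalabanUVNodesN15KingModelFullPropagatorOperatorPrinted
import Summits.QuantumFields.YangMills.Theorems.BalabanUVNodesN15KingModelFullPropagatorGradRate

/-!
# BalabanUVNodes ∕ N15 — THE KING-MODEL RUNG, CURVED EDITION (PART Q2a): THE OPERATOR PEEL OF THE GRADIENT PAIR of King's full `A = 0`
# fluctuation propagator, and a decaying kernel against a source supported away from the observation block
# (Track A, DAG node N15 = NE2; FAN-OUT v1.1 §N15 s3 «KING-MODEL RUNG …»; PART Q = NE2⁰'s OPERATOR LAYER ((3.42) sup entries) for King's full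
# propagator with genuine η-lattice test functions — this file: the two tools of the entry `|∇_U Gλ|` at `U ≡ 1`)

HONEST FRAMING.  Count-neutral kernel bookkeeping (cell `pub-ymgap`, seat `pub-ymgap-dag-n15-e` g7; `--supports stmt-QuantumFields-20292 --as helper`
= K3⁗ `SpineGivenEndpointR13Sep`, lineage K3 19676 → 19908 → 19912 → 20292).  TEMPLATE LITERATURE, `A = 0`: C. King's scalar U(1)-Higgs MODEL on
finite tori ([King1986] (2.13)–(2.17) p. 653, (2.20) p. 654, Prop. 3.8 (3.71) p. 664 second line, p. 664 «x′ ∈ B^n(x)», §4 p. 675 (4.42)–(4.43);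
B4 p. 582 (2.39)), NOT Bałaban's covariant objects; [folklore] finite sums; NE2⁺ NOT PRINTED ∕ not proved; NOT a node discharge; nothing continuum ∕
ℝ⁴ ∕ OS ∕ mass-gap ∕ Clay.  0 `sorry`, 0 `def`, standard axioms.

CONTENT.
* §1 `pairOp_decay_le` — generic: a kernel `k` on the fine torus with `|k(x′, y′)| ≤ A·e^{−κ|B x′ − B y′|}` against a source `|f| ≤ F` vanishing
  within block distance `< D` of `B(x′)` gives `|Σ_{y′}N^{−d′}k(x′, y′)f(y′)| ≤ A·K_{d′}(κ∕2)·e^{−(κ∕2)D}·F` — half the rate pays the distance to the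
  support, half the row sum (part P `rowSum_exp_blocks_le`; the `N^{d′}` fine points of a unit block cancel the measure factor).  Part P′'s
  `sliceOp_pair_decay_le` is the instance `k = ksSlice′ − ksSlice∘u`; the gradient files use it for `ksDSlice′ − ksDSlice∘u`, for the one-level
  derivative kernels and for their transposes.
* §2 **`fullPropDOp_peel_pair`** — the operator peel of the GRADIENT pair: per level the unit factor `L^{d+1}∕L²·L` of the differentiated (2.20)
  (O-b′ `fullPropD_peel_fine`, O-a′ `fullPropD_peel`) against the measure factor `L^{−(d+1)}` IS `L^{−1}` (a gradient of a propagator has mass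
  dimension `−1`):
  `Σ_{ŷ′}(L^nL^{K+1})^{−(d+1)}[L^nL^{K+1}·(G(K+1+n)(ê x̂′ + e_μ, ŷ′) − G(K+1+n)(ê x̂′, ŷ′)) − L^{K+1}·(G(K+1)(û ê x̂′ + e_μ, û ŷ′) − G(K+1)(û ê x̂′, û ŷ′))]·f̂′(ŷ′)
   = L^{−1}·Σ_{y′}(L^nL^K)^{−(d+1)}{[gradient pair one level down, mass m²∕L²] + [ksDSlice′_μ(x′, y′) − ksDSlice_μ(u x′, u y′)]}·f̂′(ê(flatten y′))`.
The induction consuming them (★ `fullPropDOp_rate_decay_unif`) is PART Q2b (`…FullPropagatorGradOperator`).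
Locators: [King1986] C. King, CMP **102** (1986) 649–677: (2.17) p. 653, (2.20) p. 654, Prop. 3.8 (3.71) p. 664, (4.42)–(4.43) p. 675; [Ba 4] =
[Balaban1983RegularityDecay] (2.39) p. 582, (5.9) p. 593.
-/

noncomputable section

namespace Summit.QuantumFields.YangMills.BalabanUVNodes.N15KingModelRung.Curved

open Real Finset Matrix
open Literature.MathematicalPhysics.QuantumFieldTheory.Balaban1983to89.B4Sect5Proof (latticeConst latticeConst_nonneg)
open Literature.MathematicalPhysics.QuantumFieldTheory.Balaban1983to89.B5Prop11Plancherel (Tor fine unitVec)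
open Literature.MathematicalPhysics.QuantumFieldTheory.King1986 (aK aK_pos)
open Literature.MathematicalPhysics.QuantumFieldTheory.King1986.Torus (constrainedProp flatten blockOf tdistT torCongr tdistT_nonneg
  tdistT_sumBound)

variable {d : ℕ} (L : ℕ) [NeZero L]

/-! ## §1 A decaying kernel against a source supported away from the observation block -/

omit [NeZero L] in
/-- **A kernel with a block-distance letter against a source supported `≥ D` blocks away, in the fine measure**: if `|k(x′, y′)| ≤
A·e^{−κ|B x′ − B y′|_U}` for all `y′`, `|f| ≤ F` and `f(y′) = 0` whenever `|B x′ − B y′|_U < D`, then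
`|Σ_{y′}N^{−d′}k(x′, y′)f(y′)| ≤ A·K_{d′}(κ∕2)·e^{−(κ∕2)D}·F` — half the rate pays the distance to the support, half the row sum
(part P `rowSum_exp_blocks_le`; the `N^{d′}` fine points of a unit block cancel the measure factor). [cite: Balaban1983RegularityDecay, (2.39) p.582, (5.9) p.593] -/
theorem pairOp_decay_le {d' : ℕ} (N : ℕ) [NeZero N] (U : Fin d' → ℕ) [∀ μ, NeZero (U μ)] {A κ : ℝ} (hκ : 0 < κ) (hA : 0 ≤ A)
    (k : Tor (fine N U) → Tor (fine N U) → ℝ) (x' : Tor (fine N U))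
    (hk : ∀ y', |k x' y'| ≤ A * Real.exp (-(κ * tdistT U (blockOf N U x') (blockOf N U y'))))
    (f : Tor (fine N U) → ℝ) {F D : ℝ} (hF : ∀ y', |f y'| ≤ F)
    (hsupp : ∀ y', f y' ≠ 0 → D ≤ tdistT U (blockOf N U x') (blockOf N U y')) :
    |∑ y', (((N : ℕ) : ℝ) ^ d')⁻¹ * k x' y' * f y'| ≤ A * latticeConst d' (κ / 2) * Real.exp (-(κ / 2 * D)) * F := by
  have hF0 : 0 ≤ F := (abs_nonneg _).trans (hF x')
  set w : ℝ := (((N : ℕ) : ℝ) ^ d')⁻¹ with hw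
  have hw0 : 0 ≤ w := by positivity
  set b₀ := blockOf N U x' with hb₀
  set E : ℝ := Real.exp (-(κ / 2 * D)) with hE
  have hterm : ∀ y', |w * k x' y' * f y'| ≤ w * (A * E * F) * Real.exp (-(κ / 2 * tdistT U b₀ (blockOf N U y'))) := by
    intro y'
    by_cases hfy : f y' = 0
    · rw [hfy, mul_zero, abs_zero]; positivity
    have hD := hsupp y' hfy
    set t : ℝ := tdistT U b₀ (blockOf N U y') with ht
    have hsplit : Real.exp (-(κ * t)) ≤ E * Real.exp (-(κ / 2 * t)) := by
      rw [hE, ← Real.exp_add]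
      have hκD : κ / 2 * D ≤ κ / 2 * t := mul_le_mul_of_nonneg_left hD (half_pos hκ).le
      exact Real.exp_le_exp.mpr (by linarith)
    rw [abs_mul, abs_mul, abs_of_nonneg hw0]
    calc w * |k x' y'| * |f y'| ≤ w * (A * Real.exp (-(κ * t))) * F :=
          mul_le_mul (mul_le_mul_of_nonneg_left (hk y') hw0) (hF y') (abs_nonneg _) (by positivity)
      _ ≤ w * (A * (E * Real.exp (-(κ / 2 * t)))) * F :=
          mul_le_mul_of_nonneg_right (mul_le_mul_of_nonneg_left (mul_le_mul_of_nonneg_left hsplit hA) hw0) hF0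
      _ = w * (A * E * F) * Real.exp (-(κ / 2 * t)) := by ring
  have hrow := rowSum_exp_blocks_le N U (half_pos hκ) b₀
  calc |∑ y', w * k x' y' * f y'|
      ≤ ∑ y', |w * k x' y' * f y'| := Finset.abs_sum_le_sum_abs _ _
    _ ≤ ∑ y', w * (A * E * F) * Real.exp (-(κ / 2 * tdistT U b₀ (blockOf N U y'))) := Finset.sum_le_sum fun y' _ => hterm y'
    _ = w * (A * E * F) * ∑ y', Real.exp (-(κ / 2 * tdistT U b₀ (blockOf N U y'))) := by rw [Finset.mul_sum]
    _ ≤ w * (A * E * F) * ((((N : ℕ) : ℝ)) ^ d' * latticeConst d' (κ / 2)) :=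
        mul_le_mul_of_nonneg_left (by exact_mod_cast hrow) (by positivity)
    _ = A * latticeConst d' (κ / 2) * E * F := by
        have hN : ((((N : ℕ) : ℝ)) ^ d') ≠ 0 := pow_ne_zero _ (by exact_mod_cast NeZero.ne N)
        rw [hw]; field_simp

/-! ## §2 The operator peel of the gradient pair -/

/-- **THE OPERATOR PEEL OF THE GRADIENT PAIR**: for the slice index `i = (e, K = i.j, n = i.n, …)`, `a > 0`, `m² > 0`, `L ≥ 2`, direction `μ`, the
spelling bridge `h`, a source `f̂′` on the `(K+1+n)`-level fine lattice over the cube `M_e` and a fine point `x′` of the nested torus: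
`Σ_{ŷ′}(L^nL^{K+1})^{−(d+1)}[L^nL^{K+1}·(G(K+1+n)(ê x̂′ + e_μ, ŷ′) − G(K+1+n)(ê x̂′, ŷ′)) − L^{K+1}·(G(K+1)(û ê x̂′ + e_μ, û ŷ′) − G(K+1)(û ê x̂′, û ŷ′))]·f̂′(ŷ′)
 = L^{−1}·Σ_{y′}(L^nL^K)^{−(d+1)}{[L^nL^K·(G(K+n)^{sub}(x′ + e_μ, y′) − G(K+n)^{sub}(x′, y′)) − L^K·(G(K)^{sub}(u x′ + e_μ, u y′) − G(K)^{sub}(u x′, u y′))]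
   + [ksDSlice′_μ(x′, y′) − ksDSlice_μ(u x′, u y′)]}·f̂′(ê(flatten y′))`
(masses `m²` upstairs, `m²∕L²` downstairs; `ê x̂′ = torCongr h (flatten x′)`; `u`, `û` King's pairings at levels `K`, `K+1`; the coarse
observation point is written `flatten (u x′)` = `û ê x̂′` by part O-b `underPtN_flatten`).
[cite: King1986, (2.17) p.653, (2.20) p.654, Prop. 3.8 (3.71) p.664 (second line, object), (4.42) p.675; Balaban1983RegularityDecay, (2.39) p.582] -/
theorem fullPropDOp_peel_pair (hL : 2 ≤ L) {a msq : ℝ} (ha : 0 < a) (hm : 0 < msq) (i : KSliceIdx d) (μ : Fin (d + 1))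
    (h : ∀ ν, fine (L ^ i.n * L ^ i.j * L) (ksM L i) ν = fine (L ^ i.n * L ^ (i.j + 1)) (ksM L i) ν)
    (f' : Tor (fine (L ^ i.n * L ^ (i.j + 1)) (ksM L i)) → ℝ) (x' : Tor (fine (L ^ i.n * L ^ i.j) (ksU L i))) :
    ∑ y'' : Tor (fine (L ^ i.n * L ^ (i.j + 1)) (ksM L i)),
        ((((L ^ i.n * L ^ (i.j + 1) : ℕ) : ℝ) ^ (d + 1))⁻¹ *
          (((L ^ i.n * L ^ (i.j + 1) : ℕ) : ℝ) *
              (constrainedProp (L ^ i.n * L ^ (i.j + 1)) (ksM L i) (aK a L (i.j + 1 + i.n))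
                  (((L ^ i.n * L ^ (i.j + 1) : ℕ) : ℝ) ^ 2) msq
                  (torCongr h (flatten (L ^ i.n * L ^ i.j) L (ksM L i) x') + unitVec (fine (L ^ i.n * L ^ (i.j + 1)) (ksM L i)) μ) y''
                - constrainedProp (L ^ i.n * L ^ (i.j + 1)) (ksM L i) (aK a L (i.j + 1 + i.n))
                  (((L ^ i.n * L ^ (i.j + 1) : ℕ) : ℝ) ^ 2) msq
                  (torCongr h (flatten (L ^ i.n * L ^ i.j) L (ksM L i) x')) y'')
            - ((L ^ i.j * L : ℕ) : ℝ) *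
              (constrainedProp (L ^ i.j * L) (ksM L i) (aK a L (i.j + 1)) (((L ^ i.j * L : ℕ) : ℝ) ^ 2) msq
                  (flatten (L ^ i.j) L (ksM L i) (underPtN L i.j i.n (ksU L i) x') + unitVec (fine (L ^ i.j * L) (ksM L i)) μ)
                  (underPtN L (i.j + 1) i.n (ksM L i) y'')
                - constrainedProp (L ^ i.j * L) (ksM L i) (aK a L (i.j + 1)) (((L ^ i.j * L : ℕ) : ℝ) ^ 2) msq
                  (flatten (L ^ i.j) L (ksM L i) (underPtN L i.j i.n (ksU L i) x'))
                  (underPtN L (i.j + 1) i.n (ksM L i) y'')))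
          * f' y'')
      = ((L : ℝ))⁻¹ *
        ∑ y' : Tor (fine (L ^ i.n * L ^ i.j) (ksU L i)),
          ((((L ^ i.n * L ^ i.j : ℕ) : ℝ) ^ (d + 1))⁻¹ *
            ((((L ^ i.n * L ^ i.j : ℕ) : ℝ) *
                  (constrainedProp (L ^ i.n * L ^ i.j) (ksU L i) (aK a L (i.j + i.n)) (((L ^ i.n * L ^ i.j : ℕ) : ℝ) ^ 2)
                      (msq / (L : ℝ) ^ 2) (x' + unitVec (fine (L ^ i.n * L ^ i.j) (ksU L i)) μ) y'
                    - constrainedProp (L ^ i.n * L ^ i.j) (ksU L i) (aK a L (i.j + i.n)) (((L ^ i.n * L ^ i.j : ℕ) : ℝ) ^ 2)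
                      (msq / (L : ℝ) ^ 2) x' y')
                - ((L ^ i.j : ℕ) : ℝ) *
                  (constrainedProp (L ^ i.j) (ksU L i) (aK a L i.j) (((L ^ i.j : ℕ) : ℝ) ^ 2) (msq / (L : ℝ) ^ 2)
                      (underPtN L i.j i.n (ksU L i) x' + unitVec (fine (L ^ i.j) (ksU L i)) μ) (underPtN L i.j i.n (ksU L i) y')
                    - constrainedProp (L ^ i.j) (ksU L i) (aK a L i.j) (((L ^ i.j : ℕ) : ℝ) ^ 2) (msq / (L : ℝ) ^ 2)
                      (underPtN L i.j i.n (ksU L i) x') (underPtN L i.j i.n (ksU L i) y')))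
              + (ksDSlice' L a (msq / (L : ℝ) ^ 2) i μ x' y'
                - ksDSlice L a (msq / (L : ℝ) ^ 2) i μ (underPtN L i.j i.n (ksU L i) x') (underPtN L i.j i.n (ksU L i) y')))
            * f' (torCongr h (flatten (L ^ i.n * L ^ i.j) L (ksM L i) y'))) := by
  have hL0 : (0 : ℝ) < L := by exact_mod_cast (show 0 < L by omega)
  have hLne : (L : ℝ) ≠ 0 := hL0.ne'
  -- re-index the fine sum along `flatten ≫ torCongr`
  rw [← ((flatten (L ^ i.n * L ^ i.j) L (ksM L i)).trans (torCongr h)).sum_comp]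
  simp only [Equiv.trans_apply]
  rw [Finset.mul_sum]
  refine Finset.sum_congr rfl fun y' _ => ?_
  rw [underPtN_flatten L i.j i.n (ksM L i) h y',
    fullPropD_peel_fine L hL ha hm i μ x' y' h, fullPropD_peel L hL ha hm i μ _ _]
  have hcast : (((L ^ i.n * L ^ (i.j + 1) : ℕ) : ℝ)) = ((L ^ i.n * L ^ i.j : ℕ) : ℝ) * L := by push_cast; ring
  rw [hcast]
  have hNK : (((L ^ i.n * L ^ i.j : ℕ) : ℝ)) ≠ 0 := by positivity
  field_simp
  ring

end Summit.QuantumFields.YangMills.BalabanUVNodes.N15KingModelRung.Curved
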